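import Summits.Parity.GeneralizedHardyLittlewood.Theorems.LeeYangFibresCellParityLawKernelInductionAux
import Summits.Parity.GeneralizedHardyLittlewood.Theorems.LeeYangFibresCellParityLawKernelInductionFibres
import HarnessLib

/-!
# Route `LeeYangFibres`, crux `CellParityLaw` (stmt-Parity-14109), line `section-annihilator`:
# the induction `KernelInduction` (skeleton v18) — summing the fibres' errors

Skeleton v18 (lead c5). In the induction step the fibres `𝒜_p`, `z < p ≤ x^{1/(n+1)} ≤ x^{1/3}`, contribute the
errors `(u+2) E_p + (16(u+1)/p)(2 V(p) A_p(x) + π_p)`, `E_p = kernelErr C κ A₂ (𝒜_p) (x/p) (p − 1/2) η_p Λ R_p`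
(`StepAux.fibre_pointwise`). This file sums them into the parent's currency (`SumsAux.fibre_errors_sum`):

  `Σ_p [(u+2) E_p + (16(u+1)/p)(2V(p)A_p(x) + π_p)] ≤ kernelErr ((u+2)(8C + C(C_F+4)) + 80(u+1)) κ (A₂ + A_F) 𝒜 x z η Λ R`,

using: the fibre bracket `η_p^κ + (log z_p)^{-κ} + log(2Λ)/log z_p ≤ 2·(parent bracket)` (`η_p ≤ (3/2)η`,
`log(p − 1/2) ≥ (1/2) log z`); `V(p) A_p(x) ≤ g(p)V(p)A(x) + |r_p(x)|` with the telescoping bound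
`Σ g(p)V(p) ≤ V(z)` (`PrimeSumAux`) and `Σ |r_p(x)| ≤ R` (`FibreDataAux`); `Σ_p R_p ≤ C_F (log x)^{A_F}(R + x/z)`
(`FibreInheritance`); `Σ (x/p)/(p − 1/2) ≤ 4x/z`; `Σ π_p ≤ A(x) ≤ x`.

References: E. Bombieri, RIMS Kôkyûroku 294 (1977) [BombieriRIMS1977].
-/

noncomputable section

open scoped BigOperators Classical
open Finset Literature.NumberTheory.Sieve

namespace Summit.Parity.GeneralizedHardyLittlewood.Cruxes.CellParityLaw.SectionAnnihilator

namespace SumsAux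

/-- `(a x)^κ ≤ a x^κ`-type bound: for `0 ≤ x`, `1 ≤ a`, `0 < κ ≤ 1`: `(a x)^κ ≤ a x^κ`. -/
theorem mul_rpow_le {a x κ : ℝ} (ha : 1 ≤ a) (hx : 0 ≤ x) (hκ1 : κ ≤ 1) :
    (a * x) ^ κ ≤ a * x ^ κ := by
  rw [Real.mul_rpow (by linarith) hx]
  refine mul_le_mul_of_nonneg_right ?_ (Real.rpow_nonneg hx κ)
  calc a ^ κ ≤ a ^ (1 : ℝ) := Real.rpow_le_rpow_of_exponent_le ha hκ1
    _ = a := Real.rpow_one a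

/-- **The fibre's bracket is at most twice the parent's**: with `η ≤ η_p ≤ (3/2)η`, `(1/2) log z ≤ log z_p`,
`0 < κ ≤ 1`, `1 ≤ log z`, `0 ≤ η`, `1/2 ≤ Λ`:
`η_p^κ + (log z_p)^{-κ} + log(2Λ)/log z_p ≤ 2 (η^κ + (log z)^{-κ} + log(2Λ)/log z)`. -/
theorem fibre_bracket_le {η ηp lz lzp Λ κ : ℝ} (hη : 0 ≤ η) (hηp : ηp ≤ 3 / 2 * η) (hηp0 : 0 ≤ ηp)
    (hlz : 1 ≤ lz) (hlzp : lz / 2 ≤ lzp) (hκ0 : 0 < κ) (hκ1 : κ ≤ 1) (hΛ : 1 / 2 ≤ Λ) :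
    ηp ^ κ + lzp ^ (-κ) + Real.log (2 * Λ) / lzp ≤ 2 * (η ^ κ + lz ^ (-κ) + Real.log (2 * Λ) / lz) := by
  have hlzp0 : 0 < lzp := by linarith
  have hl2Λ : 0 ≤ Real.log (2 * Λ) := Real.log_nonneg (by linarith)
  have h1 : ηp ^ κ ≤ 2 * η ^ κ := by
    calc ηp ^ κ ≤ (2 * η) ^ κ := Real.rpow_le_rpow hηp0 (by linarith) hκ0.le
      _ ≤ 2 * η ^ κ := mul_rpow_le (by norm_num) hη hκ1
  have h2 : lzp ^ (-κ) ≤ 2 * lz ^ (-κ) := by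
    -- `lzp^{-κ} ≤ (lz/2)^{-κ} = 2^κ lz^{-κ} ≤ 2 lz^{-κ}`
    have hh : lzp ^ (-κ) ≤ (lz / 2) ^ (-κ) :=
      Real.rpow_le_rpow_of_nonpos (by linarith) hlzp (by linarith)
    refine hh.trans ?_
    rw [Real.div_rpow (by linarith) (by norm_num), Real.rpow_neg (by norm_num : (0:ℝ) ≤ 2), div_eq_mul_inv,
      inv_inv, mul_comm]
    refine mul_le_mul_of_nonneg_right ?_ (Real.rpow_nonneg (by linarith) _)
    calc (2 : ℝ) ^ κ ≤ 2 ^ (1 : ℝ) := Real.rpow_le_rpow_of_exponent_le (by norm_num) hκ1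
      _ = 2 := Real.rpow_one 2
  have h3 : Real.log (2 * Λ) / lzp ≤ 2 * (Real.log (2 * Λ) / lz) := by
    rw [div_le_iff₀ hlzp0]
    calc Real.log (2 * Λ) = 2 * (Real.log (2 * Λ) / lz) * (lz / 2) := by field_simp
      _ ≤ 2 * (Real.log (2 * Λ) / lz) * lzp := by
          apply mul_le_mul_of_nonneg_left hlzp; positivity
  linarith

/-- `log(p − 1/2) ≥ (1/2) log p` for `p ≥ 2` (since `p − 1/2 ≥ √p`). -/
theorem log_sub_half_ge {p : ℝ} (hp : 2 ≤ p) : Real.log p / 2 ≤ Real.log (p - 1 / 2) := by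
  have hp0 : 0 < p := by linarith
  have hsq : Real.sqrt p ≤ p - 1 / 2 := by
    rw [Real.sqrt_le_left (by linarith)]
    nlinarith
  calc Real.log p / 2 = Real.log (Real.sqrt p) := by rw [Real.log_sqrt hp0.le]
    _ ≤ Real.log (p - 1 / 2) := Real.log_le_log (Real.sqrt_pos.mpr hp0) hsq

/-- **Pointwise expansion of the fibre's currency.** For a prime `z < p ≤ x^{1/3}` (`e ≤ z`, `e ≤ x`,
`0 ≤ η ≤ 1/2`, `(log x)^{-1/2} ≤ η`, `0 < κ ≤ 1`, `1 ≤ Λ`):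
`kernelErr C κ A₂ (𝒜_p) (x/p) (p − 1/2) η_p Λ R_p ≤ 2C·br·(g(p)V(p)A + |r_p(x)|) + C (log x)^{A₂}(R_p + (x/p)/(p − 1/2))`,
`br = η^κ + (log z)^{-κ} + log(2Λ)/log z`. -/
theorem fibre_kernelErr_le (𝒜 : SieveSequence) {x z η Λ C κ : ℝ} {A₂ : ℕ} {p : ℕ} (Rp : ℝ)
    (hC : 0 ≤ C) (hκ0 : 0 < κ) (hκ1 : κ ≤ 1)
    (hx : Real.exp 1 ≤ x) (hz : Real.exp 1 ≤ z) (hη0 : 0 ≤ η)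
    (hηlow : Real.log x ^ (-(1 / 2 : ℝ)) ≤ η) (hΛ : 1 ≤ Λ)
    (hg : ∀ p : ℕ, p.Prime → 0 ≤ 𝒜.density p ∧ 𝒜.density p < 1)
    (hp : p.Prime) (hzp : z < p) (hpx : (p : ℝ) ≤ x ^ (1 / 3 : ℝ)) (hRp : 0 ≤ Rp) :
    kernelErr C κ A₂ (fibreSeq 𝒜 p) (x / p) ((p : ℝ) - 1 / 2) (η * Real.log x / Real.log (x / p)) Λ Rp ≤
      2 * C * (η ^ κ + Real.log z ^ (-κ) + Real.log (2 * Λ) / Real.log z) *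
          (𝒜.density p * 𝒜.densityProduct (primesProdBelow (p : ℝ)) * 𝒜.size x + |𝒜.remainder p x|) +
        C * Real.log x ^ A₂ * (Rp + x / p / ((p : ℝ) - 1 / 2)) := by
  have he1 : 1 < Real.exp 1 := Real.one_lt_exp_iff.mpr one_pos
  have hx1 : 1 < x := he1.trans_le hx
  have hz1 : 1 < z := he1.trans_le hz
  have hx0 : 0 < x := by linarith
  have hz0 : 0 < z := by linarith
  have hp2 : (2 : ℝ) ≤ p := by exact_mod_cast hp.two_le
  have hp1 : (1 : ℝ) < p := by linarith
  have hp0 : (0 : ℝ) < p := by linarith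
  have hpn : 0 < p := hp.pos
  have hlz : 1 ≤ Real.log z := by rw [Real.le_log_iff_exp_le hz0]; exact hz
  have hlx : 1 ≤ Real.log x := by rw [Real.le_log_iff_exp_le hx0]; exact hx
  -- rewrite the fibre's density product and size
  have hVp : (fibreSeq 𝒜 p).densityProduct (primesProdBelow ((p : ℝ) - 1 / 2)) =
      𝒜.densityProduct (primesProdBelow (p : ℝ)) := by
    rw [FibreDataAux.primesProdBelow_sub_half hp.one_lt.le]; rfl
  have hBp : (fibreSeq 𝒜 p).size (x / p) = 𝒜.congrSum p x := FibreDataAux.fibreSeq_size_div 𝒜 hpn x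
  -- the fibre bracket
  have hxp3 : x ^ (1 / 3 : ℝ) < x := by
    calc x ^ (1 / 3 : ℝ) < x ^ (1 : ℝ) := Real.rpow_lt_rpow_of_exponent_lt hx1 (by norm_num)
      _ = x := Real.rpow_one x
  have hpx' : (p : ℝ) < x := lt_of_le_of_lt hpx hxp3
  obtain ⟨hηp1, hηp2, -⟩ := FibreDataAux.fibre_eta_bounds hx1 hp1 hpx hη0 hηlow
  have hηp0 : 0 ≤ η * Real.log x / Real.log (x / p) := hη0.trans hηp1
  have hlzp : Real.log z / 2 ≤ Real.log ((p : ℝ) - 1 / 2) := by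
    have h1 := log_sub_half_ge hp2
    have h2 : Real.log z ≤ Real.log p := Real.log_le_log hz0 hzp.le
    linarith
  have hbr := fibre_bracket_le (Λ := Λ) (κ := κ) hη0 hηp2 hηp0 hlz hlzp hκ0 hκ1 (by linarith)
  -- `V(p) B_p ≤ g(p) V(p) A + |r_p|`
  obtain ⟨hVp0, hVp1⟩ := ModelPrimeSumAux.densityProduct_mem_Icc 𝒜 hg (primesProdBelow (p : ℝ))
  have hrem : 𝒜.congrSum p x = 𝒜.density p * 𝒜.size x + 𝒜.remainder p x := by
    rw [SieveSequence.remainder]; ring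
  have hVB : 𝒜.densityProduct (primesProdBelow (p : ℝ)) * 𝒜.congrSum p x ≤
      𝒜.density p * 𝒜.densityProduct (primesProdBelow (p : ℝ)) * 𝒜.size x + |𝒜.remainder p x| := by
    rw [hrem, mul_add]
    have h1 : 𝒜.densityProduct (primesProdBelow (p : ℝ)) * 𝒜.remainder p x ≤ |𝒜.remainder p x| := by
      calc 𝒜.densityProduct (primesProdBelow (p : ℝ)) * 𝒜.remainder p x
          ≤ |𝒜.densityProduct (primesProdBelow (p : ℝ)) * 𝒜.remainder p x| := le_abs_self _
        _ = 𝒜.densityProduct (primesProdBelow (p : ℝ)) * |𝒜.remainder p x| := by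
            rw [abs_mul, abs_of_nonneg hVp0]
        _ ≤ 1 * |𝒜.remainder p x| := mul_le_mul_of_nonneg_right hVp1 (abs_nonneg _)
        _ = |𝒜.remainder p x| := one_mul _
    nlinarith
  have hVB0 : 0 ≤ 𝒜.densityProduct (primesProdBelow (p : ℝ)) * 𝒜.congrSum p x := by
    refine mul_nonneg hVp0 ?_
    unfold SieveSequence.congrSum
    exact Finset.sum_nonneg fun q _ => 𝒜.a_nonneg q
  -- `(log(x/p))^{A₂} ≤ (log x)^{A₂}`
  have hlxp0 : 0 ≤ Real.log (x / p) := Real.log_nonneg ((one_le_div hp0).mpr hpx'.le)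
  have hlxp : Real.log (x / p) ≤ Real.log x := by
    rw [Real.log_div hx0.ne' hp0.ne']; linarith [Real.log_pos hp1]
  have hpowlog : Real.log (x / p) ^ A₂ ≤ Real.log x ^ A₂ := pow_le_pow_left₀ hlxp0 hlxp A₂
  -- the bracket is nonnegative
  have hbr0 : 0 ≤ η ^ κ + Real.log z ^ (-κ) + Real.log (2 * Λ) / Real.log z :=
    KernelErrAux.bracket_nonneg (κ := κ) hη0 (by linarith) hz1
  have hbrp0 : 0 ≤ (η * Real.log x / Real.log (x / p)) ^ κ + Real.log ((p : ℝ) - 1 / 2) ^ (-κ) +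
      Real.log (2 * Λ) / Real.log ((p : ℝ) - 1 / 2) :=
    KernelErrAux.bracket_nonneg (κ := κ) hηp0 (by linarith) (by linarith)
  have hjunk : 0 ≤ Rp + x / p / ((p : ℝ) - 1 / 2) := by
    have : (0 : ℝ) < (p : ℝ) - 1 / 2 := by linarith
    positivity
  -- assemble
  unfold kernelErr
  rw [hVp, hBp]
  calc C * ((η * Real.log x / Real.log (x / p)) ^ κ + Real.log ((p : ℝ) - 1 / 2) ^ (-κ) +
          Real.log (2 * Λ) / Real.log ((p : ℝ) - 1 / 2)) *
          (𝒜.densityProduct (primesProdBelow (p : ℝ)) * 𝒜.congrSum p x) +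
        C * Real.log (x / p) ^ A₂ * (Rp + x / p / ((p : ℝ) - 1 / 2))
      ≤ C * (2 * (η ^ κ + Real.log z ^ (-κ) + Real.log (2 * Λ) / Real.log z)) *
          (𝒜.density p * 𝒜.densityProduct (primesProdBelow (p : ℝ)) * 𝒜.size x + |𝒜.remainder p x|) +
        C * Real.log x ^ A₂ * (Rp + x / p / ((p : ℝ) - 1 / 2)) := by
        gcongr
    _ = _ := by ring

/-- **Summing the fibres' errors into the parent's currency.** See the module docstring. The prime set `P`
consists of primes `p` with `z < p ≤ P₁ ≤ x^{1/3}` (`P ⊆ (Ioc ⌊z⌋ P₁).filter Prime`); `Rp ≥ 0` are the fibre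
Type-I bounds with `Σ_{p ∈ P} Rp p ≤ SR`; `πp ≥ 0` (the fibres' prime counts) with `Σ_{p ∈ P} πp p ≤ x`; the
hypotheses on the data are those of kernel-admissibility at `(x, z, η, Λ, R)` that are used, with `e ≤ z ≤ x`,
`e ≤ x`, `0 ≤ η ≤ 1/2`, `η_p := η log x/log(x/p)`. -/
theorem fibre_errors_sum {u : ℕ} (𝒜 : SieveSequence) {x z η Λ R C κ SR : ℝ} {A₂ : ℕ} {P : Finset ℕ} {P₁ : ℕ}
    (Rp : ℕ → ℝ) (πp : ℕ → ℝ)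
    (hC : 0 ≤ C) (hκ0 : 0 < κ) (hκ1 : κ ≤ 1)
    (hx : Real.exp 1 ≤ x) (hz : Real.exp 1 ≤ z) (hη0 : 0 ≤ η) (hη1 : η ≤ 1 / 2)
    (hηlow : Real.log x ^ (-(1 / 2 : ℝ)) ≤ η) (hΛ : 1 ≤ Λ)
    (hg : ∀ p : ℕ, p.Prime → 0 ≤ 𝒜.density p ∧ 𝒜.density p < 1)
    (hT : StrongTypeI 𝒜 x η R) (hA0 : 0 ≤ 𝒜.size x)
    (hP : P ⊆ (Finset.Ioc ⌊z⌋₊ P₁).filter Nat.Prime) (hP₁ : (P₁ : ℝ) ≤ x ^ (1 / 3 : ℝ))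
    (hRp0 : ∀ p, 0 ≤ Rp p) (hRp : ∑ p ∈ P, Rp p ≤ SR)
    (hπ0 : ∀ p, 0 ≤ πp p) (hπ : ∑ p ∈ P, πp p ≤ x) :
    ∑ p ∈ P, (((u : ℝ) + 2) * kernelErr C κ A₂ (fibreSeq 𝒜 p) (x / p) ((p : ℝ) - 1 / 2)
        (η * Real.log x / Real.log (x / p)) Λ (Rp p) +
        16 * ((u : ℝ) + 1) / p * (2 * (𝒜.densityProduct (primesProdBelow (p : ℝ)) * 𝒜.congrSum p x) + πp p)) ≤
      ((u : ℝ) + 2) * (2 * C * (η ^ κ + Real.log z ^ (-κ) + Real.log (2 * Λ) / Real.log z) *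
          (𝒜.densityProduct (primesProdBelow z) * 𝒜.size x + R) +
        C * Real.log x ^ A₂ * (SR + 4 * x / z)) +
      16 * ((u : ℝ) + 1) * ((2 * (𝒜.densityProduct (primesProdBelow z) * 𝒜.size x + R) + x) / z) := by
  have he1 : 1 < Real.exp 1 := Real.one_lt_exp_iff.mpr one_pos
  have hx1 : 1 < x := he1.trans_le hx
  have hz1 : 1 < z := he1.trans_le hz
  have hx0 : 0 < x := by linarith
  have hz0 : 0 < z := by linarith
  have hz2 : 2 ≤ z := by
    have := Real.exp_one_gt_d9; linarith
  -- notation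
  set V := 𝒜.densityProduct (primesProdBelow z) with hVdef
  set A := 𝒜.size x with hAdef
  set br := η ^ κ + Real.log z ^ (-κ) + Real.log (2 * Λ) / Real.log z with hbrdef
  set gV : ℕ → ℝ := fun p => 𝒜.density p * 𝒜.densityProduct (primesProdBelow (p : ℝ)) with hgV
  set rr : ℕ → ℝ := fun p => |𝒜.remainder p x| with hrr
  set jk : ℕ → ℝ := fun p => x / p / ((p : ℝ) - 1 / 2) with hjk
  have hbr0 : 0 ≤ br := KernelErrAux.bracket_nonneg (κ := κ) hη0 (by linarith) hz1
  have hV0 : 0 ≤ V := (ModelPrimeSumAux.densityProduct_mem_Icc 𝒜 hg _).1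
  have hlx : 1 ≤ Real.log x := by rw [Real.le_log_iff_exp_le hx0]; exact hx
  have hlogpow : 0 ≤ Real.log x ^ A₂ := pow_nonneg (by linarith) _
  -- membership facts
  have hmem : ∀ p ∈ P, p.Prime ∧ z < (p : ℝ) ∧ (p : ℝ) ≤ x ^ (1 / 3 : ℝ) := by
    intro p hp
    have hp' := hP hp
    simp only [Finset.mem_filter, Finset.mem_Ioc] at hp'
    obtain ⟨⟨hzp, hpP⟩, hpp⟩ := hp'
    refine ⟨hpp, ?_, le_trans (by exact_mod_cast hpP) hP₁⟩
    have := Nat.lt_of_floor_lt hzp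
    exact this
  -- pointwise bound
  have hpt : ∀ p ∈ P,
      ((u : ℝ) + 2) * kernelErr C κ A₂ (fibreSeq 𝒜 p) (x / p) ((p : ℝ) - 1 / 2)
          (η * Real.log x / Real.log (x / p)) Λ (Rp p) +
        16 * ((u : ℝ) + 1) / p * (2 * (𝒜.densityProduct (primesProdBelow (p : ℝ)) * 𝒜.congrSum p x) + πp p) ≤
      ((u : ℝ) + 2) * (2 * C * br * (gV p * A + rr p) + C * Real.log x ^ A₂ * (Rp p + jk p)) +
        16 * ((u : ℝ) + 1) / z * (2 * (gV p * A + rr p) + πp p) := by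
    intro p hp
    obtain ⟨hpp, hzp, hpx⟩ := hmem p hp
    have hp2 : (2 : ℝ) ≤ p := by exact_mod_cast hpp.two_le
    have hp0 : (0 : ℝ) < p := by linarith
    have hK := fibre_kernelErr_le (A₂ := A₂) 𝒜 (Rp p) hC hκ0 hκ1 hx hz hη0 hηlow hΛ hg hpp hzp hpx (hRp0 p)
    -- `V(p) B_p ≤ g(p)V(p)A + |r_p|` again, for the shift part
    obtain ⟨hVp0, hVp1⟩ := ModelPrimeSumAux.densityProduct_mem_Icc 𝒜 hg (primesProdBelow (p : ℝ))
    have hrem : 𝒜.congrSum p x = 𝒜.density p * 𝒜.size x + 𝒜.remainder p x := by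
      rw [SieveSequence.remainder]; ring
    have hVB : 𝒜.densityProduct (primesProdBelow (p : ℝ)) * 𝒜.congrSum p x ≤ gV p * A + rr p := by
      rw [hgV, hrr, hAdef]
      dsimp only
      rw [hrem, mul_add]
      have h1 : 𝒜.densityProduct (primesProdBelow (p : ℝ)) * 𝒜.remainder p x ≤ |𝒜.remainder p x| := by
        calc 𝒜.densityProduct (primesProdBelow (p : ℝ)) * 𝒜.remainder p x
            ≤ |𝒜.densityProduct (primesProdBelow (p : ℝ)) * 𝒜.remainder p x| := le_abs_self _
          _ = 𝒜.densityProduct (primesProdBelow (p : ℝ)) * |𝒜.remainder p x| := by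
              rw [abs_mul, abs_of_nonneg hVp0]
          _ ≤ 1 * |𝒜.remainder p x| := mul_le_mul_of_nonneg_right hVp1 (abs_nonneg _)
          _ = |𝒜.remainder p x| := one_mul _
      nlinarith
    have hVB0 : 0 ≤ 𝒜.densityProduct (primesProdBelow (p : ℝ)) * 𝒜.congrSum p x := by
      refine mul_nonneg hVp0 ?_
      unfold SieveSequence.congrSum
      exact Finset.sum_nonneg fun q _ => 𝒜.a_nonneg q
    have hsh0 : 0 ≤ 2 * (𝒜.densityProduct (primesProdBelow (p : ℝ)) * 𝒜.congrSum p x) + πp p := by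
      have := hπ0 p; positivity
    have hshift : 16 * ((u : ℝ) + 1) / p * (2 * (𝒜.densityProduct (primesProdBelow (p : ℝ)) * 𝒜.congrSum p x) + πp p)
        ≤ 16 * ((u : ℝ) + 1) / z * (2 * (gV p * A + rr p) + πp p) := by
      calc 16 * ((u : ℝ) + 1) / p * (2 * (𝒜.densityProduct (primesProdBelow (p : ℝ)) * 𝒜.congrSum p x) + πp p)
          ≤ 16 * ((u : ℝ) + 1) / z * (2 * (𝒜.densityProduct (primesProdBelow (p : ℝ)) * 𝒜.congrSum p x) + πp p) := by
            apply mul_le_mul_of_nonneg_right _ hsh0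
            exact div_le_div_of_nonneg_left (by positivity) hz0 hzp.le
        _ ≤ 16 * ((u : ℝ) + 1) / z * (2 * (gV p * A + rr p) + πp p) := by
            apply mul_le_mul_of_nonneg_left _ (by positivity)
            linarith
    have hu2 : (0 : ℝ) ≤ (u : ℝ) + 2 := by positivity
    have hKu := mul_le_mul_of_nonneg_left hK hu2
    rw [hbrdef, hgV, hrr, hjk] at *
    linarith
  -- sum the pointwise bounds
  refine (Finset.sum_le_sum hpt).trans ?_
  -- the four sums (all summands are nonnegative at primes, and the superset consists of primes)
  have hsub : ∀ (f : ℕ → ℝ), (∀ p, p.Prime → 0 ≤ f p) →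
      ∑ p ∈ P, f p ≤ ∑ p ∈ (Finset.Ioc ⌊z⌋₊ P₁).filter Nat.Prime, f p := fun f hf =>
    Finset.sum_le_sum_of_subset_of_nonneg hP fun p hp _ => hf p (Finset.mem_filter.mp hp).2
  have hgV0 : ∀ p, p.Prime → 0 ≤ gV p := fun p hpp =>
    mul_nonneg (hg p hpp).1 (ModelPrimeSumAux.densityProduct_mem_Icc 𝒜 hg _).1
  have hrr0 : ∀ p, 0 ≤ rr p := fun p => abs_nonneg _
  have hjk0 : ∀ p : ℕ, p.Prime → z < (p : ℝ) → 0 ≤ jk p := fun p hpp _ => by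
    rw [hjk]; dsimp only
    have hp2 : (2 : ℝ) ≤ p := by exact_mod_cast hpp.two_le
    have hph : (0 : ℝ) < (p : ℝ) - 1 / 2 := by linarith
    have hp0 : (0 : ℝ) < p := by linarith
    exact div_nonneg (div_nonneg hx0.le hp0.le) hph.le
  -- (1) `Σ g(p)V(p) ≤ V`
  have hS1 : ∑ p ∈ P, gV p ≤ V :=
    (hsub gV hgV0).trans (PrimeSumAux.sum_density_mul_densityProduct_le 𝒜 hg z P₁)
  -- (2) `Σ |r_p(x)| ≤ R`
  have hP₁' : (P₁ : ℝ) ≤ x ^ (1 - η) := by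
    refine hP₁.trans (Real.rpow_le_rpow_of_exponent_le hx1.le ?_)
    linarith
  have hS2 : ∑ p ∈ P, rr p ≤ R :=
    (hsub rr fun p _ => hrr0 p).trans (FibreDataAux.sum_abs_remainder_primes_le 𝒜 hT hP₁')
  -- (3) junk `Σ (x/p)/(p − 1/2) ≤ 4x/z`
  have hS3 : ∑ p ∈ P, jk p ≤ 4 * x / z := by
    have h := PrimeSumAux.sum_div_mul_sub_half_le hx0.le hz2 P₁
    refine le_trans ?_ h
    refine Finset.sum_le_sum_of_subset_of_nonneg hP fun p hp _ => ?_
    have hp' := Finset.mem_filter.mp hp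
    exact hjk0 p hp'.2 (Nat.lt_of_floor_lt (Finset.mem_Ioc.mp hp'.1).1)
  -- rewrite the summed bound and conclude
  have hsum_eq : ∑ p ∈ P, (((u : ℝ) + 2) * (2 * C * br * (gV p * A + rr p) + C * Real.log x ^ A₂ * (Rp p + jk p)) +
        16 * ((u : ℝ) + 1) / z * (2 * (gV p * A + rr p) + πp p)) =
      ((u : ℝ) + 2) * (2 * C * br * ((∑ p ∈ P, gV p) * A + ∑ p ∈ P, rr p) +
          C * Real.log x ^ A₂ * (∑ p ∈ P, Rp p + ∑ p ∈ P, jk p)) +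
        16 * ((u : ℝ) + 1) / z * (2 * ((∑ p ∈ P, gV p) * A + ∑ p ∈ P, rr p) + ∑ p ∈ P, πp p) := by
    simp only [Finset.sum_add_distrib, Finset.mul_sum, Finset.sum_mul, mul_add, add_mul]
  rw [hsum_eq]
  have hu2 : (0 : ℝ) ≤ (u : ℝ) + 2 := by positivity
  have hu1 : (0 : ℝ) ≤ 16 * ((u : ℝ) + 1) / z := by positivity
  have hgA : (∑ p ∈ P, gV p) * A ≤ V * A := mul_le_mul_of_nonneg_right hS1 hA0
  have h1 : 2 * C * br * ((∑ p ∈ P, gV p) * A + ∑ p ∈ P, rr p) ≤ 2 * C * br * (V * A + R) := by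
    apply mul_le_mul_of_nonneg_left _ (by positivity)
    linarith
  have h2 : C * Real.log x ^ A₂ * (∑ p ∈ P, Rp p + ∑ p ∈ P, jk p) ≤ C * Real.log x ^ A₂ * (SR + 4 * x / z) := by
    apply mul_le_mul_of_nonneg_left _ (by positivity)
    linarith
  have h3 : 16 * ((u : ℝ) + 1) / z * (2 * ((∑ p ∈ P, gV p) * A + ∑ p ∈ P, rr p) + ∑ p ∈ P, πp p) ≤
      16 * ((u : ℝ) + 1) / z * (2 * (V * A + R) + x) := by
    apply mul_le_mul_of_nonneg_left _ hu1
    linarith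
  have h3' : 16 * ((u : ℝ) + 1) / z * (2 * (V * A + R) + x) =
      16 * ((u : ℝ) + 1) * ((2 * (V * A + R) + x) / z) := by ring
  calc ((u : ℝ) + 2) * (2 * C * br * ((∑ p ∈ P, gV p) * A + ∑ p ∈ P, rr p) +
          C * Real.log x ^ A₂ * (∑ p ∈ P, Rp p + ∑ p ∈ P, jk p)) +
        16 * ((u : ℝ) + 1) / z * (2 * ((∑ p ∈ P, gV p) * A + ∑ p ∈ P, rr p) + ∑ p ∈ P, πp p)
      ≤ ((u : ℝ) + 2) * (2 * C * br * (V * A + R) + C * Real.log x ^ A₂ * (SR + 4 * x / z)) +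
        16 * ((u : ℝ) + 1) / z * (2 * (V * A + R) + x) :=
        add_le_add (mul_le_mul_of_nonneg_left (add_le_add h1 h2) hu2) h3
    _ = _ := by rw [h3']

/-- **`stub_fibreBracket`** (registered auxiliary sub-goal of stmt-Parity-14109, induction of skeleton v18): the
fibre's relative bracket is at most twice the parent's. -/
theorem stub_fibreBracket : ∀ (η ηp lz lzp Λ κ : ℝ), 0 ≤ η → ηp ≤ 3 / 2 * η → 0 ≤ ηp → 1 ≤ lz → lz / 2 ≤ lzp →
    0 < κ → κ ≤ 1 → 1 / 2 ≤ Λ →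
    ηp ^ κ + lzp ^ (-κ) + Real.log (2 * Λ) / lzp ≤ 2 * (η ^ κ + lz ^ (-κ) + Real.log (2 * Λ) / lz) :=
  fun _ _ _ _ _ _ hη hηp hηp0 hlz hlzp hκ0 hκ1 hΛ => fibre_bracket_le hη hηp hηp0 hlz hlzp hκ0 hκ1 hΛ

end SumsAux

end Summit.Parity.GeneralizedHardyLittlewood.Cruxes.CellParityLaw.SectionAnnihilator

end
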